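import Summits.HubbardSuperconductivity.HubbardSuperconductivity.Theorems.AnisotropyChordTransferFibre3TwoHoleBS

/-!
# Route `AnisotropyChord` / H0 rotor rung: PROP BS on an ARBITRARY finite point family — the point certificate (interface for the overlapping-cross near classes)

Twenty-third file of the `TwoHoleBS` (PROP BS) chain; first stone of the reduced-slot treatment of the overlapping-cross classes
`d ∈ D₄·{(1,0),(1,1),(2,0)}` (memo HOLE2NEAR-LEAN-g3 §5(a)), where the ten-slot kernel matrix `skelA d` is singular (coincident
slots) and the certificate must be built on the DISTINCT points `ζ ∪ {live boundary points}` with multiplicities `N ∈ {1,2}`.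
Generalisation of `…Fibre3TwoHoleBS.{chargeOf, dualCert_of_matrixCert}` from the fixed family `bsPt` to any `pts : κ → Tor L`:
* `ptCharge`, `sum_conj_ptCharge_mul`, `sum_mul_ptCharge`, `greenQF_ptCharge`;
* `PointCert g z₁ z₂ pts N E` (for `φ` vanishing on the pair: `½ Σ_k N_k‖φ(pts k)‖² ≤ 2Re⟨Eψ,ψ⟩ − Re (Eψ)ᴴ G̃ (Eψ)`, `ψ = φ ∘ pts`),
  ★ `dualCert_of_pointCert` (given the boundary-mass identity `nbr φ z₁ + nbr φ z₂ = Σ_k N_k‖φ(pts k)‖²`);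
* the real form: `re_quad_realK`, `re_inner_realK`, ★ `pointCert_of_real` (a REAL charge map `E` and the real
  inequality `½ Σ N_k u_k² ≤ 2(Eu)·u − (Eu)ᵀ(Λ̃·11ᵀ − A_L)(Eu)` on real `u` vanishing at the indices of the pair suffice).
Prover seat `hubbard-h0-rotor-p2` g3; helper for stmt-HubbardSuperconductivity-19089 (`--supports`, helper class).
WHAT THIS IS NOT: nothing here proves superconductivity in the Hubbard model; the rotor TARGET as originally worded stays
FALSE (g15 verdict).  Interface only (no pair is certified here).  Mathlib + tree imports only; no sorry, no axioms.
-/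

set_option linter.dupNamespace false
set_option autoImplicit false

noncomputable section

open scoped BigOperators
open Complex Finset

namespace Summit.HubbardSuperconductivity.HubbardSuperconductivity.Theorems.AnisotropyChord.Transfer.Fibre3

namespace TwoHoleBS

variable (L : ℕ) [NeZero L] {κ : Type*} [Fintype κ]

/-! ## Charges carried by a finite point family -/

/-- the lattice charge carried by weights `w` on the points `pts` (coincident points add up). [folklore] -/
def ptCharge (pts : κ → Tor L) (w : κ → ℂ) : Tor L → ℂ := fun x => ∑ k, if pts k = x then w k else 0

/-- pairing a carried charge with a lattice function. [folklore] -/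
theorem sum_conj_ptCharge_mul (pts : κ → Tor L) (w : κ → ℂ) (F : Tor L → ℂ) :
    ∑ x : Tor L, (starRingEnd ℂ) (ptCharge L pts w x) * F x = ∑ k, (starRingEnd ℂ) (w k) * F (pts k) := by
  unfold ptCharge
  simp_rw [map_sum, Finset.sum_mul]
  rw [Finset.sum_comm]
  refine Finset.sum_congr rfl fun k _ => ?_
  simp_rw [apply_ite (starRingEnd ℂ), map_zero, ite_mul, zero_mul]
  rw [Finset.sum_ite_eq]
  simp

/-- pairing a lattice function with a carried charge. [folklore] -/
theorem sum_mul_ptCharge (pts : κ → Tor L) (w : κ → ℂ) (F : Tor L → ℂ) :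
    ∑ y : Tor L, F y * ptCharge L pts w y = ∑ k, F (pts k) * w k := by
  unfold ptCharge
  simp_rw [Finset.mul_sum]
  rw [Finset.sum_comm]
  refine Finset.sum_congr rfl fun k _ => ?_
  simp_rw [mul_ite, mul_zero]
  rw [Finset.sum_ite_eq]
  simp

/-- the Green quadratic form of a carried charge. [folklore] -/
theorem greenQF_ptCharge (g : ℝ) (pts : κ → Tor L) (w : κ → ℂ) :
    greenQF L g (ptCharge L pts w) = ∑ k, ∑ l, (starRingEnd ℂ) (w k) * greenW L g (pts k - pts l) * w l := by
  unfold greenQF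
  have h1 : ∀ x : Tor L, ∑ y : Tor L, (starRingEnd ℂ) (ptCharge L pts w x) * greenW L g (x - y) * ptCharge L pts w y
      = (starRingEnd ℂ) (ptCharge L pts w x) * ∑ l, greenW L g (x - pts l) * w l := by
    intro x
    rw [← sum_mul_ptCharge L pts w (fun y => greenW L g (x - y)), Finset.mul_sum]
    exact Finset.sum_congr rfl fun y _ => by rw [mul_assoc]
  rw [Finset.sum_congr rfl fun x _ => h1 x, sum_conj_ptCharge_mul L pts w (fun x => ∑ l, greenW L g (x - pts l) * w l)]
  refine Finset.sum_congr rfl fun k _ => ?_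
  rw [Finset.mul_sum]
  exact Finset.sum_congr rfl fun l _ => by rw [mul_assoc]

/-! ## The point certificate -/

/-- POINT CERTIFICATE for the pair `(z₁, z₂)` on the point family `pts` with boundary weights `N`: a charge map `E` with
`½ Σ_k N_k‖ψ_k‖² ≤ 2Re⟨Eψ,ψ⟩ − Re (Eψ)ᴴ G̃ (Eψ)` for `ψ = φ ∘ pts`, every `φ` vanishing on the pair. [folklore] -/
def PointCert (g : ℝ) (z₁ z₂ : Tor L) (pts : κ → Tor L) (N : κ → ℝ) (E : Matrix κ κ ℂ) : Prop :=
  ∀ φ : Tor L → ℂ, φ z₁ = 0 → φ z₂ = 0 →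
    (1 / 2 : ℝ) * ∑ k, N k * ‖φ (pts k)‖ ^ 2
      ≤ 2 * (∑ k, (starRingEnd ℂ) (E.mulVec (fun l => φ (pts l)) k) * φ (pts k)).re
        - (∑ k, ∑ l, (starRingEnd ℂ) (E.mulVec (fun l => φ (pts l)) k) * greenW L g (pts k - pts l)
            * E.mulVec (fun l => φ (pts l)) l).re

/-- ★ **a point certificate is a dual certificate**, provided the point family carries the boundary mass:
`nbr φ z₁ + nbr φ z₂ = Σ_k N_k‖φ(pts k)‖²` for `φ` vanishing on the pair. [folklore] -/
theorem dualCert_of_pointCert {g : ℝ} {z₁ z₂ : Tor L} (pts : κ → Tor L) (N : κ → ℝ) (E : Matrix κ κ ℂ)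
    (hnbr : ∀ φ : Tor L → ℂ, φ z₁ = 0 → φ z₂ = 0 → nbr L φ z₁ + nbr L φ z₂ = ∑ k, N k * ‖φ (pts k)‖ ^ 2)
    (hE : PointCert L g z₁ z₂ pts N E) : DualCert L g z₁ z₂ := by
  intro φ h1 h2 _hsum
  refine ⟨ptCharge L pts (E.mulVec fun l => φ (pts l)), ?_⟩
  rw [hnbr φ h1 h2, sum_conj_ptCharge_mul, greenQF_ptCharge]
  exact hE φ h1 h2

/-! ## The real form -/

/-- `Re cᴴ G c = (Re c)ᵀG(Re c) + (Im c)ᵀG(Im c)` for a real matrix `G`. [folklore] -/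
theorem re_quad_realK (G : Matrix κ κ ℝ) (c : κ → ℂ) :
    (∑ k, ∑ l, (starRingEnd ℂ) (c k) * ((G k l : ℝ) : ℂ) * c l).re
      = dotProduct (fun k => (c k).re) (G.mulVec fun k => (c k).re)
        + dotProduct (fun k => (c k).im) (G.mulVec fun k => (c k).im) := by
  simp only [dotProduct, Matrix.mulVec, Finset.mul_sum, ← Finset.sum_add_distrib, Complex.re_sum]
  refine Finset.sum_congr rfl fun p _ => Finset.sum_congr rfl fun q _ => ?_
  simp only [Complex.mul_re, Complex.mul_im, Complex.conj_re, Complex.conj_im, Complex.ofReal_re, Complex.ofReal_im,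
    mul_zero, sub_zero]
  ring

/-- `Re ⟨c, ψ⟩ = (Re c)·(Re ψ) + (Im c)·(Im ψ)`. [folklore] -/
theorem re_inner_realK (c ψ : κ → ℂ) :
    (∑ k, (starRingEnd ℂ) (c k) * ψ k).re
      = dotProduct (fun k => (c k).re) (fun k => (ψ k).re) + dotProduct (fun k => (c k).im) (fun k => (ψ k).im) := by
  simp only [dotProduct, ← Finset.sum_add_distrib, Complex.re_sum]
  refine Finset.sum_congr rfl fun k _ => ?_
  simp only [Complex.mul_re, Complex.conj_re, Complex.conj_im]
  ring

/-- `mulVec` by a real matrix commutes with real / imaginary parts. [folklore] -/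
theorem mulVec_ofReal_re_im (E : Matrix κ κ ℝ) (ψ : κ → ℂ) (k : κ) :
    ((E.map Complex.ofReal).mulVec ψ k).re = E.mulVec (fun l => (ψ l).re) k ∧
      ((E.map Complex.ofReal).mulVec ψ k).im = E.mulVec (fun l => (ψ l).im) k := by
  constructor <;> simp [Matrix.mulVec, dotProduct, Matrix.map_apply, Complex.mul_re, Complex.mul_im]

/-- the real Green matrix of a point family, `G_{kl} = 2·Gres L (2g) (pts k − pts l)` (`= Λ̃ − a_L(pts k − pts l)`). [folklore] -/
def greenMatK (g : ℝ) (pts : κ → Tor L) : Matrix κ κ ℝ := Matrix.of fun k l => 2 * Gres L (2 * g) (pts k - pts l)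

/-- ★ **REAL FORM OF THE POINT CERTIFICATE:** a real charge map `E` with
`½ Σ_k N_k u_k² ≤ 2(Eu)·u − (Eu)ᵀ G (Eu)` for every real `u` vanishing at the indices carrying the pair gives `PointCert`. [folklore] -/
theorem pointCert_of_real {g : ℝ} {z₁ z₂ : Tor L} (pts : κ → Tor L) (N : κ → ℝ) (E : Matrix κ κ ℝ)
    (hpos : ∀ u : κ → ℝ, (∀ k, (pts k = z₁ ∨ pts k = z₂) → u k = 0) →
      (1 / 2 : ℝ) * ∑ k, N k * u k ^ 2
        ≤ 2 * dotProduct (E.mulVec u) u - dotProduct (E.mulVec u) ((greenMatK L g pts).mulVec (E.mulVec u))) :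
    PointCert L g z₁ z₂ pts N (E.map Complex.ofReal) := by
  intro φ h1 h2
  set ψ : κ → ℂ := fun l => φ (pts l) with hψ
  set u : κ → ℝ := fun l => (ψ l).re with hu
  set v : κ → ℝ := fun l => (ψ l).im with hv
  have hu0 : ∀ k, (pts k = z₁ ∨ pts k = z₂) → u k = 0 := by
    intro k hk
    rcases hk with hk | hk <;> simp [hu, hψ, hk, h1, h2]
  have hv0 : ∀ k, (pts k = z₁ ∨ pts k = z₂) → v k = 0 := by
    intro k hk
    rcases hk with hk | hk <;> simp [hv, hψ, hk, h1, h2]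
  set c := (E.map Complex.ofReal).mulVec ψ with hc
  have hcre : (fun k => (c k).re) = E.mulVec u := by
    funext k; exact (mulVec_ofReal_re_im E ψ k).1
  have hcim : (fun k => (c k).im) = E.mulVec v := by
    funext k; exact (mulVec_ofReal_re_im E ψ k).2
  -- the three terms in real form
  have hlhs : ∑ k, N k * ‖φ (pts k)‖ ^ 2 = ∑ k, N k * u k ^ 2 + ∑ k, N k * v k ^ 2 := by
    rw [← Finset.sum_add_distrib]
    refine Finset.sum_congr rfl fun k _ => ?_
    have : ‖φ (pts k)‖ ^ 2 = u k ^ 2 + v k ^ 2 := by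
      rw [Complex.sq_norm, Complex.normSq_apply]; simp only [hu, hv, hψ]; ring
    rw [this]; ring
  have hinner : (∑ k, (starRingEnd ℂ) (c k) * ψ k).re = dotProduct (E.mulVec u) u + dotProduct (E.mulVec v) v := by
    rw [re_inner_realK, hcre, hcim]
  have hG : ∀ k l, greenW L g (pts k - pts l) = ((greenMatK L g pts k l : ℝ) : ℂ) := by
    intro k l
    apply Complex.ext
    · rw [Complex.ofReal_re, greenW_re]; rfl
    · rw [Complex.ofReal_im, greenW_im]
  have hquad : (∑ k, ∑ l, (starRingEnd ℂ) (c k) * greenW L g (pts k - pts l) * c l).re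
      = dotProduct (E.mulVec u) ((greenMatK L g pts).mulVec (E.mulVec u))
        + dotProduct (E.mulVec v) ((greenMatK L g pts).mulVec (E.mulVec v)) := by
    simp_rw [hG]
    rw [re_quad_realK, hcre, hcim]
  show (1 / 2 : ℝ) * ∑ k, N k * ‖φ (pts k)‖ ^ 2
      ≤ 2 * (∑ k, (starRingEnd ℂ) (c k) * ψ k).re - (∑ k, ∑ l, (starRingEnd ℂ) (c k) * greenW L g (pts k - pts l) * c l).re
  rw [hlhs, hinner, hquad]
  have h1' := hpos u hu0
  have h2' := hpos v hv0
  linarith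

end TwoHoleBS

end Summit.HubbardSuperconductivity.HubbardSuperconductivity.Theorems.AnisotropyChord.Transfer.Fibre3

end
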